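import Mathlib.LinearAlgebra.SesquilinearForm.Basic
import Mathlib.Tactic.LinearCombination
import Mathlib.Tactic.FieldSimp
import HarnessLib

/-!
# Rank-one hermitian rigidity: `h(·, x) ⊗ x` determines `x` up to a norm-one scalar ([Lang2002, Ch. XV §5])

Topic `LinearAlgebra/Semilinear`; namespace `Literature.LinearAlgebra.Semilinear`.  KERNEL ONLY (theorems, Mathlib
only; no named fact, no definition).

Setting (Mathlib's sesquilinear API, as in `Semilinear/HermitianOrthogonalBasis`): `K` a field, `σ : K →+* K` an
INVOLUTION (`σ (σ a) = a`), `V` a `K`-module and `B : V →ₛₗ[σ] V →ₗ[K] K` a form, `σ`-semilinear in the first and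
linear in the second variable (so `B x v` is the classical `h(v, x)`, linear in `v` and `σ`-semilinear in `x`),
which SEPARATES ON THE LEFT (`LinearMap.SeparatingLeft`: `B x = 0 ⇒ x = 0`; for a hermitian = `LinearMap.IsSymm`
form this is non-degeneracy).  Neither hermitian symmetry nor finite dimension is needed.

* `exists_smul_eq_of_forall_mul_apply_eq` — **rank-one rigidity**: if the rank-one hermitian operators attached to
  `x` and `x'` have the same matrix coefficients, `h(v, x) σ(h(w, x)) = h(v, x') σ(h(w, x'))` for all `v, w`, then
  `x' = λ • x` for a scalar of norm one, `λ σ(λ) = 1` (if `x = 0` then `x' = 0` and `λ = 1`; otherwise pick `w` with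
  `h(w, x) ≠ 0`, so `h(w, x') ≠ 0` by the diagonal identity, and `h(·, x') = c · h(·, x)` with
  `c = σ h(w,x) / σ h(w,x')`, whence `x' = σ(c) • x` by separation and `c σ(c) = 1` by the diagonal identity);
* `exists_smul_eq_of_forall_smul_eq` — the same from the operator identity `h(v, x) x = h(v, x') x'` for all `v`;
* `eq_zero_iff_of_forall_mul_apply_eq` — in particular `x = 0 ↔ x' = 0`;
* `forall_mul_apply_eq_of_smul_eq` — the (trivial) converse.

This is the uniqueness statement behind "a vector of a non-degenerate hermitian space is determined, up to `U(1)`, by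
the rank-one form `v ↦ h(v, x) x`" (polar decomposition of rank-one hermitian operators), used for the unitary
dual pair `(U(1), U(V))` (the moment map `x ↦ x x*` has the `U(1)`-orbits as fibres; [MoeglinVignerasWaldspurger1987]
Ch. 3, [Howe1979] §11).

## References
* S. Lang, *Algebra*, rev. 3rd ed., GTM 211 (2002), Ch. XV §5 (hermitian and sesquilinear forms; non-degeneracy)
  [Lang2002].
* C. Mœglin, M.-F. Vignéras, J.-L. Waldspurger, *Correspondances de Howe sur un corps p-adique*, LNM 1291 (1987),
  Ch. 3 [MoeglinVignerasWaldspurger1987].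
-/

set_option autoImplicit false

namespace Literature.LinearAlgebra.Semilinear

variable {K : Type*} [Field K] {V : Type*} [AddCommGroup V] [Module K V] {σ : K →+* K}

/-- In a field with involution, `a · σ a = 0 ↔ a = 0`. [cite: Lang2002, Ch. XV §5] -/
private theorem mul_map_self_eq_zero_iff (a : K) : a * σ a = 0 ↔ a = 0 := by
  rw [mul_eq_zero, map_eq_zero, or_self]

/-- The converse (sanity) direction: for `x' = λ • x` with `λ σ(λ) = 1` the rank-one coefficients agree,
`h(v, x') σ(h(w, x')) = h(v, x) σ(h(w, x))`. [cite: Lang2002, Ch. XV §5] -/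
theorem forall_mul_apply_eq_of_smul_eq (B : V →ₛₗ[σ] V →ₗ[K] K) (hσ : ∀ a : K, σ (σ a) = a) {x x' : V}
    {c : K} (hc : c * σ c = 1) (hx' : x' = c • x) (v w : V) :
    B x v * σ (B x w) = B x' v * σ (B x' w) := by
  subst hx'
  rw [LinearMap.map_smulₛₗ₂, LinearMap.map_smulₛₗ₂, smul_eq_mul, smul_eq_mul, map_mul, hσ]
  linear_combination (-(B x v * σ (B x w))) * hc

/-- **Rank-one hermitian rigidity.** Let `B : V →ₛₗ[σ] V →ₗ[K] K` (`σ` an involution of the field `K`) separate on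
the left.  If `x, x' ∈ V` have the same rank-one coefficients, `h(v, x) σ(h(w, x)) = h(v, x') σ(h(w, x'))` for all
`v, w` (with `h(v, x) = B x v`), then `x' = λ • x` for some `λ` with `λ σ(λ) = 1`.  (No hermitian symmetry and no
finite-dimensionality are used.) [cite: Lang2002, Ch. XV §5] -/
theorem exists_smul_eq_of_forall_mul_apply_eq (B : V →ₛₗ[σ] V →ₗ[K] K) (hσ : ∀ a : K, σ (σ a) = a)
    (hB : B.SeparatingLeft) {x x' : V} (h : ∀ v w : V, B x v * σ (B x w) = B x' v * σ (B x' w)) :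
    ∃ c : K, c * σ c = 1 ∧ x' = c • x := by
  by_cases hx : x = 0
  · -- then `h(v, x') σ h(v, x') = 0`, so `h(·, x') = 0` and `x' = 0`
    subst hx
    refine ⟨1, by rw [map_one, one_mul], ?_⟩
    rw [smul_zero]
    refine hB x' fun v => ?_
    have e := h v v
    rw [map_zero, LinearMap.zero_apply, zero_mul] at e
    exact (mul_map_self_eq_zero_iff _).mp e.symm
  · -- pick `w` with `h(w, x) ≠ 0`; then `h(w, x') ≠ 0`
    obtain ⟨w, hw⟩ : ∃ w, B x w ≠ 0 := by
      by_contra! hw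
      exact hx (hB x hw)
    have hd : B x w * σ (B x w) = B x' w * σ (B x' w) := h w w
    have hw' : B x' w ≠ 0 := by
      intro h0
      rw [h0, zero_mul, mul_map_self_eq_zero_iff] at hd
      exact hw hd
    have hσw' : σ (B x' w) ≠ 0 := (map_ne_zero σ).mpr hw'
    -- `h(v, x') = c h(v, x)` with `c = σ h(w,x) / σ h(w,x')`
    set c : K := σ (B x w) / σ (B x' w) with hc
    have hcoef : ∀ v, B x' v = c * B x v := fun v => by
      have e := h v w
      rw [hc, div_mul_eq_mul_div, eq_div_iff hσw', mul_comm (σ (B x w))]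
      exact e.symm
    refine ⟨σ c, ?_, ?_⟩
    · -- `σ(c) c = 1` from the diagonal identity at `w`
      rw [hσ, hc, map_div₀, hσ, hσ, div_mul_div_comm, div_eq_one_iff_eq (mul_ne_zero hw' hσw')]
      exact hd
    · -- `h(·, x' - σ(c) x) = 0`
      rw [← sub_eq_zero]
      refine hB _ fun v => ?_
      rw [map_sub, LinearMap.sub_apply, LinearMap.map_smulₛₗ₂, smul_eq_mul, hσ, hcoef, sub_self]

/-- **Rank-one hermitian rigidity, operator form**: if the rank-one operators `v ↦ h(v, x) x` and
`v ↦ h(v, x') x'` coincide, then `x' = λ • x` with `λ σ(λ) = 1` (apply the functionals `h(w, ·)` to get the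
coefficient identity of `exists_smul_eq_of_forall_mul_apply_eq`). [cite: Lang2002, Ch. XV §5] -/
theorem exists_smul_eq_of_forall_smul_eq (B : V →ₛₗ[σ] V →ₗ[K] K) (hσ : ∀ a : K, σ (σ a) = a)
    (hB : B.SeparatingLeft) {x x' : V} (h : ∀ v : V, B x v • x = B x' v • x') :
    ∃ c : K, c * σ c = 1 ∧ x' = c • x := by
  refine exists_smul_eq_of_forall_mul_apply_eq B hσ hB fun v w => ?_
  have e := congrArg (fun u => σ (B u w)) (h v)
  simpa only [LinearMap.map_smulₛₗ₂, smul_eq_mul, map_mul, hσ, mul_comm (B x v), mul_comm (B x' v)] using e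

/-- Under the hypotheses of `exists_smul_eq_of_forall_mul_apply_eq`, `x = 0 ↔ x' = 0`. [cite: Lang2002, Ch. XV §5] -/
theorem eq_zero_iff_of_forall_mul_apply_eq (B : V →ₛₗ[σ] V →ₗ[K] K) (hσ : ∀ a : K, σ (σ a) = a)
    (hB : B.SeparatingLeft) {x x' : V} (h : ∀ v w : V, B x v * σ (B x w) = B x' v * σ (B x' w)) :
    x = 0 ↔ x' = 0 := by
  obtain ⟨c, hc, rfl⟩ := exists_smul_eq_of_forall_mul_apply_eq B hσ hB h
  have hc0 : c ≠ 0 := fun h0 => by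
    rw [h0, zero_mul] at hc
    exact zero_ne_one hc
  rw [smul_eq_zero, or_iff_right hc0]

end Literature.LinearAlgebra.Semilinear
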